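import Literature.Analysis.FluidPDE.SereginSverakAxisymmetric
import Literature.Analysis.FluidPDE.SpaceTimeRescaling
import HarnessLib

/-!
# Seregin–Šverák 2009, §4: the near-maximum selection (elementary lemmas)

Support file for the blow-up step of G. Seregin, V. Šverák, *On Type I singularities of the
local axi-symmetric solutions of the Navier–Stokes equations*, Comm. PDE 34 (2009) =
arXiv:0804.1803, §4 (arXiv p. 11), in the vocabulary of
`Literature.Analysis.FluidPDE.SereginSverakAxisymmetric`. Everything here is elementary real
analysis / measure theory, proved in full:

* cylindrical-radius algebra (`horiz`, `norm_horiz`, `cylRadius_add_le`, …);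
* a.e. bounds on an open set hold everywhere for continuous representatives
  (`forall_le_of_ae_le_of_continuousOn`);
* "`z = 0` singular" forces a continuous representative to be unbounded on every `Q(r)`
  (`exists_lt_norm_of_not_isRegularAtOrigin`);
* the near-maximum selection replacing the printed running maxima
  `h(t_k) = H(t_k) = |v(x_k, t_k)|` of §4: maximise `Φ(z) = |v(z)| d(z)` over a compact box below
  a time `τ < 0`, `d` the parabolic distance to the lateral and bottom faces (`selWeight`); at a
  maximiser `z₀`, `|v| ≤ 2|v(z₀)|` on the backward cylinder of size `d(z₀)/2` about `z₀`
  (`norm_le_two_mul_of_isMaxOn`), and `|v(z₀)| d(z₀)` dominates `ρ |v(ζ)|` for every `ζ ∈ Q(ρ)` at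
  time `τ` (`exists_isMaxOn_selBox`). This is the standard weighted-maximum ("point-picking")
  device; it sidesteps the localisation of the printed `sup_{x ∈ 𝒞̄}` (module docstring of
  `SereginSverakBlowup`).

## References

* G. Seregin, V. Šverák, Comm. PDE 34 (2009), arXiv:0804.1803, §4 p. 11. [`SereginSverak2009`]
-/

noncomputable section

open MeasureTheory Set Function Filter Topology TopologicalSpace
open scoped NNReal ENNReal

namespace Literature.Analysis.FluidPDE

namespace SereginSverak2009

/-- Local notation for physical space `ℝ³ = EuclideanSpace ℝ (Fin 3)`. -/
local notation "ℝ³" => EuclideanSpace ℝ (Fin 3)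

/-! ### Cylindrical-radius algebra -/

/-- The horizontal part `x' = x - x₃ e₃ = (x₁, x₂, 0)` of a point of `ℝ³`. [folklore] -/
def horiz (x : ℝ³) : ℝ³ :=
  x - x 2 • eZ

/-- `(x')₁ = x₁`. [folklore] -/
@[simp] theorem horiz_apply_zero (x : ℝ³) : horiz x 0 = x 0 := by
  simp [horiz, eZ]

/-- `(x')₂ = x₂`. [folklore] -/
@[simp] theorem horiz_apply_one (x : ℝ³) : horiz x 1 = x 1 := by
  simp [horiz, eZ]

/-- `(x')₃ = 0`. [folklore] -/
@[simp] theorem horiz_apply_two (x : ℝ³) : horiz x 2 = 0 := by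
  simp [horiz, eZ]

/-- `x = x' + x₃ e₃`. [folklore] -/
theorem horiz_add_smul_eZ (x : ℝ³) : horiz x + x 2 • eZ = x := by
  simp [horiz]

/-- `‖x'‖ = |x'|` is the cylindrical radius. [folklore] -/
theorem norm_horiz (x : ℝ³) : ‖horiz x‖ = cylRadius x := by
  rw [EuclideanSpace.norm_eq, cylRadius]
  congr 1
  simp [Fin.sum_univ_three, sq_abs]

/-- `(x + y)' = x' + y'`. [folklore] -/
theorem horiz_add (x y : ℝ³) : horiz (x + y) = horiz x + horiz y := by
  simp only [horiz, PiLp.add_apply, add_smul]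
  abel

/-- `(c x)' = c x'`. [folklore] -/
theorem horiz_smul (c : ℝ) (x : ℝ³) : horiz (c • x) = c • horiz x := by
  simp only [horiz, PiLp.smul_apply, smul_eq_mul, smul_sub, mul_smul]

/-- `(-x)' = -x'`. [folklore] -/
theorem horiz_neg (x : ℝ³) : horiz (-x) = -horiz x := by
  simpa using horiz_smul (-1) x

/-- `(b e₃)' = 0`. [folklore] -/
@[simp] theorem horiz_smul_eZ (b : ℝ) : horiz (b • eZ : ℝ³) = 0 := by
  simp [horiz, eZ]

/-- Triangle inequality for the cylindrical radius (a seminorm). [folklore] -/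
theorem cylRadius_add_le (x y : ℝ³) : cylRadius (x + y) ≤ cylRadius x + cylRadius y := by
  rw [← norm_horiz, ← norm_horiz, ← norm_horiz, horiz_add]
  exact norm_add_le _ _

/-- `|(-x)'| = |x'|`. [folklore] -/
@[simp] theorem cylRadius_neg (x : ℝ³) : cylRadius (-x) = cylRadius x := by
  rw [← norm_horiz, ← norm_horiz, horiz_neg, norm_neg]

/-- `|(x - y)'| = |(y - x)'|`. [folklore] -/
theorem cylRadius_sub_comm (x y : ℝ³) : cylRadius (x - y) = cylRadius (y - x) := by
  rw [← cylRadius_neg, neg_sub]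

/-- `|x'| ≤ |y'| + |(x - y)'|`. [folklore] -/
theorem cylRadius_le_cylRadius_add (x y : ℝ³) : cylRadius x ≤ cylRadius y + cylRadius (x - y) := by
  simpa [add_comm] using cylRadius_add_le y (x - y)

/-- `|(b e₃ + x)'| = |x'|`. [folklore] -/
@[simp] theorem cylRadius_smul_eZ_add (b : ℝ) (x : ℝ³) : cylRadius (b • eZ + x) = cylRadius x := by
  rw [← norm_horiz, ← norm_horiz, horiz_add, horiz_smul_eZ, zero_add]

/-- `|x'| ≤ ‖x‖`. [folklore] -/
theorem cylRadius_le_norm' (x : ℝ³) : cylRadius x ≤ ‖x‖ := by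
  rw [cylRadius, EuclideanSpace.norm_eq]
  apply Real.sqrt_le_sqrt
  simp only [Fin.sum_univ_three, Real.norm_eq_abs, sq_abs]
  nlinarith [sq_nonneg (x 2)]

/-- `‖x‖² = |x'|² + x₃²`. [folklore] -/
theorem norm_sq_eq_cylRadius_sq_add (x : ℝ³) : ‖x‖ ^ 2 = cylRadius x ^ 2 + x 2 ^ 2 := by
  rw [EuclideanSpace.norm_eq, Real.sq_sqrt (by positivity), cylRadius_sq]
  simp [Fin.sum_univ_three, sq_abs]

/-- `‖x‖ ≤ |x'| + |x₃|`. [folklore] -/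
theorem norm_le_cylRadius_add_abs (x : ℝ³) : ‖x‖ ≤ cylRadius x + |x 2| := by
  have h1 : ‖x‖ ^ 2 ≤ (cylRadius x + |x 2|) ^ 2 := by
    rw [norm_sq_eq_cylRadius_sq_add, add_sq, sq_abs]
    nlinarith [cylRadius_nonneg x, abs_nonneg (x 2)]
  exact (pow_le_pow_iff_left₀ (norm_nonneg x)
    (add_nonneg (cylRadius_nonneg x) (abs_nonneg _)) two_ne_zero).1 h1

/-- The third coordinate of `x₃ e₃ + c y` is `x₃ + c y₃`. [folklore] -/
theorem smul_eZ_add_smul_apply_two (b c : ℝ) (y : ℝ³) : (b • eZ + c • y : ℝ³) 2 = b + c * y 2 := by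
  simp [eZ]

/-! ### From almost-everywhere to everywhere for continuous representatives -/

/-- On an open set, an a.e. inequality between two functions continuous on that set holds at
every point (the failure set is open and null, hence empty, Lebesgue measure charging every
non-empty open set). [folklore] -/
theorem forall_le_of_ae_le_of_continuousOn {X : Type*} [TopologicalSpace X] [MeasurableSpace X]
    [OpensMeasurableSpace X] {μ : Measure X} [μ.IsOpenPosMeasure] {U : Set X} (hU : IsOpen U)
    {f g : X → ℝ} (hf : ContinuousOn f U) (hg : ContinuousOn g U)
    (h : ∀ᵐ z ∂μ.restrict U, f z ≤ g z) : ∀ z ∈ U, f z ≤ g z := by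
  by_contra hcon
  push Not at hcon
  obtain ⟨z, hzU, hlt⟩ := hcon
  have hopen : IsOpen (U ∩ (fun w => f w - g w) ⁻¹' Ioi 0) :=
    (hf.sub hg).isOpen_inter_preimage hU isOpen_Ioi
  have hpos : 0 < μ (U ∩ (fun w => f w - g w) ⁻¹' Ioi 0) :=
    hopen.measure_pos μ ⟨z, hzU, by simpa using hlt⟩
  have hnull : μ.restrict U {w | ¬ f w ≤ g w} = 0 := ae_iff.1 h
  rw [Measure.restrict_apply' hU.measurableSet] at hnull
  have hsub : U ∩ (fun w => f w - g w) ⁻¹' Ioi 0 ⊆ {w | ¬ f w ≤ g w} ∩ U := by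
    rintro w ⟨hwU, hw⟩
    exact ⟨by simpa using hw, hwU⟩
  exact hpos.ne' (measure_mono_null hsub hnull)

/-- An a.e. bound `F(z, u z) ≤ C` for `u` on an open set `U ⊆ Q` transfers to every point of `U`
for a representative `v` continuous on `U` with `v = u` a.e. on `U`, provided `z ↦ F(z, v z)`
is continuous on `U`. Version for bounds of the form `φ z * ‖·‖ ≤ C` with `φ` continuous on `U`
(used with `φ = √(-t)` for (r3) and `φ = |x'|` for (p2)). [folklore] -/
theorem forall_mul_norm_le_of_ae {U : Set (ℝ × ℝ³)} (hU : IsOpen U) {φ : ℝ × ℝ³ → ℝ}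
    (hφ : ContinuousOn φ U) {v : ℝ × ℝ³ → ℝ³} (hv : ContinuousOn v U) {u : ℝ → ℝ³ → ℝ³}
    (hvu : v =ᵐ[volume.restrict U] uncurry u) {C : ℝ}
    (h : ∀ᵐ z ∂(volume.restrict U), φ z * ‖u z.1 z.2‖ ≤ C) : ∀ z ∈ U, φ z * ‖v z‖ ≤ C := by
  have h' : ∀ᵐ z ∂(volume.restrict U), φ z * ‖v z‖ ≤ C := by
    filter_upwards [h, hvu] with z hz hz'
    rw [hz']
    exact hz
  exact forall_le_of_ae_le_of_continuousOn hU (hφ.mul hv.norm) continuousOn_const h'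

/-! ### Singular origin: a continuous representative is unbounded on every `Q(r)` -/

/-- If `z = 0` is not a regular point of `u` (`u` is essentially unbounded on every `Q(r)`), then
a function `v` equal to `u` a.e. on `Q` exceeds every bound somewhere on `Q(r)`, `0 < r ≤ 1`.
[cite: SereginSverak2009, §4 (arXiv p. 11), "`M_k = |v(x_k,t_k)| → +∞`"] -/
theorem exists_lt_norm_of_not_isRegularAtOrigin {u : ℝ → ℝ³ → ℝ³} {v : ℝ × ℝ³ → ℝ³}
    (hsing : ¬ IsRegularAtOrigin u) (hvu : v =ᵐ[volume.restrict (parCyl 0 1)] uncurry u)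
    {r : ℝ} (hr : 0 < r) (hr1 : r ≤ 1) (K : ℝ) : ∃ z ∈ parCyl 0 r, K < ‖v z‖ := by
  by_contra hcon
  push Not at hcon
  apply hsing
  refine ⟨r, hr, ?_⟩
  have hsub : parCyl 0 r ⊆ parCyl 0 1 := parCyl_mono 0 hr.le hr1
  have hae : v =ᵐ[volume.restrict (parCyl 0 r)] uncurry u :=
    ae_restrict_of_ae_restrict_of_subset hsub hvu
  rw [eLpNorm_congr_ae hae.symm, eLpNorm_exponent_top]
  refine lt_of_le_of_lt (eLpNormEssSup_le_of_ae_bound (C := K) ?_) ENNReal.ofReal_lt_top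
  exact ae_restrict_of_forall_mem (isOpen_parCyl 0 r).measurableSet fun z hz => hcon z hz

/-- A function continuous on `Q` is bounded on every compact subset of `Q`. [folklore] -/
theorem exists_bound_of_isCompact {v : ℝ × ℝ³ → ℝ³} (hv : ContinuousOn v (parCyl 0 1))
    {K : Set (ℝ × ℝ³)} (hK : IsCompact K) (hKQ : K ⊆ parCyl 0 1) :
    ∃ B : ℝ, ∀ z ∈ K, ‖v z‖ ≤ B :=
  hK.exists_bound_of_continuousOn (hv.mono hKQ)

/-! ### The selection box, its weight, and backward cylinders -/

/-- The compact box `{-(2ρ)² ≤ t ≤ τ, |x'| ≤ 2ρ, |x₃| ≤ 2ρ}` below the time `τ` over which the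
weighted maximum is taken. [folklore] -/
def selBox (ρ τ : ℝ) : Set (ℝ × ℝ³) :=
  {z | z.1 ∈ Icc (-(2 * ρ) ^ 2) τ ∧ cylRadius z.2 ≤ 2 * ρ ∧ |z.2 2| ≤ 2 * ρ}

/-- Membership in the selection box, unfolded. [folklore] -/
theorem mem_selBox {ρ τ : ℝ} {z : ℝ × ℝ³} :
    z ∈ selBox ρ τ ↔ z.1 ∈ Icc (-(2 * ρ) ^ 2) τ ∧ cylRadius z.2 ≤ 2 * ρ ∧ |z.2 2| ≤ 2 * ρ :=
  Iff.rfl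

/-- The weight `d(z) = min(2ρ - |x'|, 2ρ - |x₃|, √(t + (2ρ)²))`: the parabolic distance from `z`
to the lateral and bottom faces of the box. [folklore] -/
def selWeight (ρ : ℝ) (z : ℝ × ℝ³) : ℝ :=
  min (2 * ρ - cylRadius z.2) (min (2 * ρ - |z.2 2|) (Real.sqrt (z.1 + (2 * ρ) ^ 2)))

/-- The backward cylinder `{t₀ - σ² < t ≤ t₀} × 𝒞(x₀, σ)` about `z₀ = (t₀, x₀)` (top slice
included). [folklore] -/
def backCyl (z₀ : ℝ × ℝ³) (σ : ℝ) : Set (ℝ × ℝ³) :=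
  {z | z.1 ∈ Ioc (z₀.1 - σ ^ 2) z₀.1 ∧ z.2 ∈ spaceCyl z₀.2 σ}

/-- Membership in a backward cylinder, unfolded. [folklore] -/
theorem mem_backCyl {z₀ z : ℝ × ℝ³} {σ : ℝ} :
    z ∈ backCyl z₀ σ ↔
      z.1 ∈ Ioc (z₀.1 - σ ^ 2) z₀.1 ∧ cylRadius (z.2 - z₀.2) < σ ∧ |z.2 2 - z₀.2 2| < σ :=
  Iff.rfl

/-- The centre belongs to its backward cylinders of positive size. [folklore] -/
theorem self_mem_backCyl (z₀ : ℝ × ℝ³) {σ : ℝ} (hσ : 0 < σ) : z₀ ∈ backCyl z₀ σ := by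
  rw [mem_backCyl]
  refine ⟨⟨by nlinarith, le_rfl⟩, ?_, ?_⟩
  · simpa [cylRadius] using hσ
  · simpa using hσ

/-- The weight is continuous. [folklore] -/
theorem continuous_selWeight (ρ : ℝ) : Continuous (selWeight ρ) := by
  unfold selWeight
  have h1 : Continuous fun z : ℝ × ℝ³ => cylRadius z.2 := continuous_cylRadius.comp continuous_snd
  have h2 : Continuous fun z : ℝ × ℝ³ => |z.2 2| := by fun_prop
  have h3 : Continuous fun z : ℝ × ℝ³ => Real.sqrt (z.1 + (2 * ρ) ^ 2) := by fun_prop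
  exact (continuous_const.sub h1).min ((continuous_const.sub h2).min h3)

/-- The weight is at most `2ρ`. [folklore] -/
theorem selWeight_le (ρ : ℝ) (z : ℝ × ℝ³) : selWeight ρ z ≤ 2 * ρ :=
  (min_le_left _ _).trans (by linarith [cylRadius_nonneg z.2])

/-- The weight is at most the distance to the lateral face `|x'| = 2ρ`. [folklore] -/
theorem selWeight_le_sub_cylRadius (ρ : ℝ) (z : ℝ × ℝ³) : selWeight ρ z ≤ 2 * ρ - cylRadius z.2 :=
  min_le_left _ _

/-- The weight is at most the distance to the faces `|x₃| = 2ρ`. [folklore] -/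
theorem selWeight_le_sub_abs (ρ : ℝ) (z : ℝ × ℝ³) : selWeight ρ z ≤ 2 * ρ - |z.2 2| :=
  (min_le_right _ _).trans (min_le_left _ _)

/-- The weight is at most the parabolic distance `√(t + (2ρ)²)` to the bottom. [folklore] -/
theorem selWeight_le_sqrt (ρ : ℝ) (z : ℝ × ℝ³) : selWeight ρ z ≤ Real.sqrt (z.1 + (2 * ρ) ^ 2) :=
  (min_le_right _ _).trans (min_le_right _ _)

/-- Lower bounds for the weight, face by face. [folklore] -/
theorem le_selWeight_iff {ρ : ℝ} {z : ℝ × ℝ³} {d : ℝ} :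
    d ≤ selWeight ρ z ↔
      d ≤ 2 * ρ - cylRadius z.2 ∧ d ≤ 2 * ρ - |z.2 2| ∧ d ≤ Real.sqrt (z.1 + (2 * ρ) ^ 2) := by
  simp only [selWeight, le_min_iff]

/-- On `Q(ρ)` the weight is at least `ρ` (for `ρ ≥ 0`). [folklore] -/
theorem le_selWeight_of_mem_parCyl {ρ : ℝ} (hρ : 0 ≤ ρ) {ζ : ℝ × ℝ³} (hζ : ζ ∈ parCyl 0 ρ) :
    ρ ≤ selWeight ρ ζ := by
  rw [mem_parCyl_zero] at hζ
  obtain ⟨⟨ht1, _⟩, hr, h3⟩ := hζ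
  rw [le_selWeight_iff]
  refine ⟨by linarith, by linarith, ?_⟩
  rw [Real.le_sqrt hρ (by nlinarith)]
  nlinarith

/-- The selection box lies in `Q(R)` whenever `2ρ < R` and `τ < 0` (and `0 < ρ`). [folklore] -/
theorem selBox_subset_parCyl {ρ τ R : ℝ} (hρ : 0 < ρ) (hR : 2 * ρ < R) (hτ : τ < 0) :
    selBox ρ τ ⊆ parCyl 0 R := by
  intro z hz
  rw [mem_selBox] at hz
  rw [mem_parCyl_zero]
  have h4 : (2 * ρ) ^ 2 < R ^ 2 := by nlinarith
  exact ⟨⟨by linarith [hz.1.1], lt_of_le_of_lt hz.1.2 hτ⟩, lt_of_le_of_lt hz.2.1 hR,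
    lt_of_le_of_lt hz.2.2 hR⟩

/-- The selection box is compact. [folklore] -/
theorem isCompact_selBox (ρ τ : ℝ) : IsCompact (selBox ρ τ) := by
  have hS : selBox ρ τ = Icc (-(2 * ρ) ^ 2) τ ×ˢ {x : ℝ³ | cylRadius x ≤ 2 * ρ ∧ |x 2| ≤ 2 * ρ} := by
    ext z; simp [selBox, mem_prod]
  rw [hS]
  refine isCompact_Icc.prod (Metric.isCompact_of_isClosed_isBounded ?_ ?_)
  · have h1 : Continuous fun x : ℝ³ => cylRadius x := continuous_cylRadius
    have h2 : Continuous fun x : ℝ³ => |x 2| := by fun_prop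
    exact (isClosed_le h1 continuous_const).inter (isClosed_le h2 continuous_const)
  · rw [isBounded_iff_forall_norm_le]
    refine ⟨2 * ρ + 2 * ρ, fun x hx => ?_⟩
    exact (norm_le_cylRadius_add_abs x).trans (add_le_add hx.1 hx.2)

/-- **Control on the backward cylinder of half the weight.** If `z₀` lies in the box with
`d(z₀) > 0`, every point `z` of the backward cylinder of size `d(z₀)/2` about `z₀` lies in the
box and has `d(z) ≥ d(z₀)/2` (`|x'|` and `|x₃|` move by less than `d(z₀)/2`, and
`t + (2ρ)² > d(z₀)² - d(z₀)²/4`). [folklore] -/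
theorem mem_selBox_and_le_selWeight_of_mem_backCyl {ρ τ : ℝ} {z₀ z : ℝ × ℝ³}
    (hz₀ : z₀ ∈ selBox ρ τ) (hd : 0 < selWeight ρ z₀)
    (hz : z ∈ backCyl z₀ (selWeight ρ z₀ / 2)) :
    z ∈ selBox ρ τ ∧ selWeight ρ z₀ / 2 ≤ selWeight ρ z := by
  set d := selWeight ρ z₀ with hd_def
  rw [mem_selBox] at hz₀
  rw [mem_backCyl] at hz
  obtain ⟨⟨ht1, ht2⟩, hrad, hax⟩ := hz
  have hdc : d ≤ 2 * ρ - cylRadius z₀.2 := selWeight_le_sub_cylRadius ρ z₀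
  have hda : d ≤ 2 * ρ - |z₀.2 2| := selWeight_le_sub_abs ρ z₀
  have hds : d ≤ Real.sqrt (z₀.1 + (2 * ρ) ^ 2) := selWeight_le_sqrt ρ z₀
  -- radial displacement
  have hr1 : cylRadius z.2 ≤ cylRadius z₀.2 + cylRadius (z.2 - z₀.2) :=
    cylRadius_le_cylRadius_add z.2 z₀.2
  have hr2 : cylRadius z.2 < cylRadius z₀.2 + d / 2 := by linarith
  -- axial displacement
  have ha1 : |z.2 2| ≤ |z₀.2 2| + |z.2 2 - z₀.2 2| := by
    have := abs_add_le (z₀.2 2) (z.2 2 - z₀.2 2)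
    rwa [add_sub_cancel] at this
  have ha2 : |z.2 2| < |z₀.2 2| + d / 2 := by linarith
  -- time displacement
  have hsq : d ^ 2 ≤ z₀.1 + (2 * ρ) ^ 2 := by
    have h0 : 0 ≤ z₀.1 + (2 * ρ) ^ 2 := by nlinarith [hz₀.1.1]
    calc d ^ 2 ≤ Real.sqrt (z₀.1 + (2 * ρ) ^ 2) ^ 2 := pow_le_pow_left₀ hd.le hds 2
      _ = z₀.1 + (2 * ρ) ^ 2 := Real.sq_sqrt h0
  have ht3 : (d / 2) ^ 2 ≤ z.1 + (2 * ρ) ^ 2 := by nlinarith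
  have hsqrt : d / 2 ≤ Real.sqrt (z.1 + (2 * ρ) ^ 2) := by
    rw [Real.le_sqrt (by linarith) ((sq_nonneg _).trans ht3)]
    exact ht3
  refine ⟨⟨⟨by nlinarith, ht2.trans hz₀.1.2⟩, by linarith, by linarith⟩, ?_⟩
  rw [le_selWeight_iff]
  exact ⟨by linarith, by linarith, hsqrt⟩

/-- **The weighted maximum.** For `v` continuous on `Q`, `0 < ρ` with `2ρ < 1`, and a point
`ζ ∈ Q(ρ)`, the function `Φ(z) = ‖v z‖ d(z)` attains its maximum over the compact box below the
time `τ = ζ.1` at some `z₀`; then `ρ ‖v ζ‖ ≤ ‖v z₀‖ d(z₀)`. [folklore] -/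
theorem exists_isMaxOn_selBox {v : ℝ × ℝ³ → ℝ³} (hv : ContinuousOn v (parCyl 0 1)) {ρ : ℝ}
    (hρ : 0 < ρ) (hρ1 : 2 * ρ < 1) {ζ : ℝ × ℝ³} (hζ : ζ ∈ parCyl 0 ρ) :
    ∃ z₀ ∈ selBox ρ ζ.1,
      IsMaxOn (fun z => ‖v z‖ * selWeight ρ z) (selBox ρ ζ.1) z₀ ∧
        ρ * ‖v ζ‖ ≤ ‖v z₀‖ * selWeight ρ z₀ := by
  have hζ' := hζ
  rw [mem_parCyl_zero] at hζ'
  have hτ : ζ.1 < 0 := hζ'.1.2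
  have hsub : selBox ρ ζ.1 ⊆ parCyl 0 1 := selBox_subset_parCyl hρ hρ1 hτ
  have hζbox : ζ ∈ selBox ρ ζ.1 := by
    rw [mem_selBox]
    refine ⟨⟨by nlinarith [hζ'.1.1], le_rfl⟩, by linarith [hζ'.2.1], by linarith [hζ'.2.2]⟩
  have hcont : ContinuousOn (fun z => ‖v z‖ * selWeight ρ z) (selBox ρ ζ.1) :=
    (hv.mono hsub).norm.mul (continuous_selWeight ρ).continuousOn
  obtain ⟨z₀, hz₀, hmax⟩ :=
    (isCompact_selBox ρ ζ.1).exists_isMaxOn ⟨ζ, hζbox⟩ hcont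
  refine ⟨z₀, hz₀, hmax, ?_⟩
  have h1 : ‖v ζ‖ * selWeight ρ ζ ≤ ‖v z₀‖ * selWeight ρ z₀ := hmax hζbox
  have h2 : ρ ≤ selWeight ρ ζ := le_selWeight_of_mem_parCyl hρ.le hζ
  calc ρ * ‖v ζ‖ = ‖v ζ‖ * ρ := mul_comm _ _
    _ ≤ ‖v ζ‖ * selWeight ρ ζ := mul_le_mul_of_nonneg_left h2 (norm_nonneg _)
    _ ≤ ‖v z₀‖ * selWeight ρ z₀ := h1

/-- **Doubling bound at a weighted maximiser.** If `z₀` maximises `‖v‖ d` over the box and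
`d(z₀) > 0`, then `‖v z‖ ≤ 2 ‖v z₀‖` on the backward cylinder of size `d(z₀)/2` about `z₀`
(there `d ≥ d(z₀)/2`, so `‖v z‖ d(z₀)/2 ≤ ‖v z‖ d(z) ≤ ‖v z₀‖ d(z₀)`). This replaces the printed
`h(t_k) = H(t_k)` (running maxima give the factor `1`). [folklore] -/
theorem norm_le_two_mul_of_isMaxOn {v : ℝ × ℝ³ → ℝ³} {ρ τ : ℝ} {z₀ : ℝ × ℝ³}
    (hz₀ : z₀ ∈ selBox ρ τ) (hmax : IsMaxOn (fun z => ‖v z‖ * selWeight ρ z) (selBox ρ τ) z₀)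
    (hd : 0 < selWeight ρ z₀) {z : ℝ × ℝ³} (hz : z ∈ backCyl z₀ (selWeight ρ z₀ / 2)) :
    ‖v z‖ ≤ 2 * ‖v z₀‖ := by
  obtain ⟨hzbox, hdz⟩ := mem_selBox_and_le_selWeight_of_mem_backCyl hz₀ hd hz
  have h1 : ‖v z‖ * selWeight ρ z ≤ ‖v z₀‖ * selWeight ρ z₀ := hmax hzbox
  have h2 : ‖v z‖ * (selWeight ρ z₀ / 2) ≤ ‖v z‖ * selWeight ρ z :=
    mul_le_mul_of_nonneg_left hdz (norm_nonneg _)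
  nlinarith [norm_nonneg (v z), norm_nonneg (v z₀)]

/-- Backward cylinders about points of the box (of size at most half the weight) stay inside
`Q(R)` for `2ρ < R`, `τ < 0`. [folklore] -/
theorem backCyl_subset_parCyl {ρ τ R : ℝ} (hρ : 0 < ρ) (hR : 2 * ρ < R) (hτ : τ < 0)
    {z₀ : ℝ × ℝ³} (hz₀ : z₀ ∈ selBox ρ τ) (hd : 0 < selWeight ρ z₀) :
    backCyl z₀ (selWeight ρ z₀ / 2) ⊆ parCyl 0 R := fun _ hz =>
  selBox_subset_parCyl hρ hR hτ (mem_selBox_and_le_selWeight_of_mem_backCyl hz₀ hd hz).1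

/-- **Near-maximum selection (the centres `z_k` of the blow-up).** Let `v` be continuous on `Q`
and equal a.e. to `u`, and let `z = 0` be a singular point of `u`. For every `N > 0` there are a
point `z₀ ∈ Q(1/8)` with `|x₀,₃| ≤ 1/10` and a size `0 < d ≤ 1/10` such that `N ≤ ‖v z₀‖ d`,
`‖v‖ ≤ 2‖v z₀‖` on the backward cylinder `{t₀ - d²/4 < t ≤ t₀} × 𝒞(x₀, d/2)`, and that cylinder
lies in `Q(1/8)` (weighted maximum over the box with `ρ = 1/20` below the time of a point of
`Q(1/20)` where `‖v‖ > 20N`). Replaces the running maxima of §4.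
[cite: SereginSverak2009, §4 (selection of `x_k, t_k, M_k`, arXiv p. 11)] -/
theorem exists_centre {u : ℝ → ℝ³ → ℝ³} {v : ℝ × ℝ³ → ℝ³} (hv : ContinuousOn v (parCyl 0 1))
    (hvu : v =ᵐ[volume.restrict (parCyl 0 1)] uncurry u) (hsing : ¬ IsRegularAtOrigin u)
    {N : ℝ} (hN : 0 < N) :
    ∃ z₀ : ℝ × ℝ³, ∃ d : ℝ, z₀ ∈ parCyl 0 (1 / 8) ∧ |z₀.2 2| ≤ 1 / 10 ∧ 0 < d ∧ d ≤ 1 / 10 ∧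
      N ≤ ‖v z₀‖ * d ∧ (∀ z ∈ backCyl z₀ (d / 2), ‖v z‖ ≤ 2 * ‖v z₀‖) ∧
      backCyl z₀ (d / 2) ⊆ parCyl 0 (1 / 8) := by
  obtain ⟨ζ, hζ, hζN⟩ := exists_lt_norm_of_not_isRegularAtOrigin hsing hvu
    (r := 1 / 20) (by norm_num) (by norm_num) (20 * N)
  obtain ⟨z₀, hz₀, hmax, hΦ⟩ :=
    exists_isMaxOn_selBox hv (ρ := 1 / 20) (by norm_num) (by norm_num) hζ
  have hζ1 : ζ.1 < 0 := ((mem_parCyl_zero).1 hζ).1.2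
  have hd : 0 < selWeight (1 / 20) z₀ := by
    by_contra h
    push Not at h
    have h1 : ‖v z₀‖ * selWeight (1 / 20) z₀ ≤ 0 := mul_nonpos_of_nonneg_of_nonpos (norm_nonneg _) h
    nlinarith [norm_nonneg (v ζ)]
  refine ⟨z₀, selWeight (1 / 20) z₀, ?_, ?_, hd, ?_, ?_, ?_, ?_⟩
  · exact selBox_subset_parCyl (by norm_num) (by norm_num) hζ1 hz₀
  · have h1 := ((mem_selBox).1 hz₀).2.2
    linarith
  · have h1 := selWeight_le (1 / 20) z₀
    linarith
  · nlinarith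
  · intro z hz
    exact norm_le_two_mul_of_isMaxOn hz₀ hmax hd hz
  · exact backCyl_subset_parCyl (by norm_num) (by norm_num) hζ1 hz₀ hd

/-! ### Geometry of the axis-centred rescaling `Φ(s, y) = (t₀ + c² s, x₃⁰ e₃ + c y)` -/

/-- Rotations about the axis are additive. [folklore] -/
theorem rotZ_add_vec (θ : ℝ) (x y : ℝ³) : rotZ θ (x + y) = rotZ θ x + rotZ θ y := by
  ext i
  fin_cases i <;> simp [rotZ] <;> ring

/-- Rotations about the axis commute with dilations. [folklore] -/
theorem rotZ_smul_vec (θ c : ℝ) (x : ℝ³) : rotZ θ (c • x) = c • rotZ θ x := by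
  ext i
  fin_cases i <;> simp [rotZ] <;> ring

/-- Rotations about the axis fix the axis. [folklore] -/
@[simp] theorem rotZ_smul_eZ (θ b : ℝ) : rotZ θ (b • eZ : ℝ³) = b • eZ := by
  ext i
  fin_cases i <;> simp [rotZ, eZ]

/-- The axis-centred rescaling commutes with the rotations:
`R_θ(b e₃ + c y) = b e₃ + c R_θ y`. [folklore] -/
theorem rotZ_smul_eZ_add_smul (θ b c : ℝ) (y : ℝ³) :
    rotZ θ (b • eZ + c • y) = b • eZ + c • rotZ θ y := by
  rw [rotZ_add_vec, rotZ_smul_eZ, rotZ_smul_vec]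

/-- A pointwise axisymmetric slice stays axisymmetric under the axis-centred rescaling
`y ↦ a • u(b e₃ + c y)`. [folklore] -/
theorem isAxisymmetric_rescale {w : ℝ³ → ℝ³} (hw : IsAxisymmetric w) (a b c : ℝ) :
    IsAxisymmetric fun y => a • w (b • eZ + c • y) := by
  intro θ y
  simp only
  rw [← rotZ_smul_eZ_add_smul, hw θ, ← rotZ_smul_vec]

/-- The preimage of the cylinder `Q((t₀, x₀), r)` under `Φ(s, y) = (t₀ + c² s, x₀ + c y)` is
`Q(0, r/c)` (`c > 0`). [folklore] -/
theorem stAffine_preimage_parCyl {c : ℝ} (hc : 0 < c) (t₀ : ℝ) (x₀ : ℝ³) (r : ℝ) :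
    stAffine (c ^ 2) c t₀ x₀ ⁻¹' parCyl (t₀, x₀) r = parCyl 0 (r / c) := by
  ext ⟨s, y⟩
  rw [mem_preimage, mem_parCyl_zero, stAffine_apply, mem_parCyl]
  simp only [add_sub_cancel_left, mem_Ioo, PiLp.add_apply, PiLp.smul_apply, smul_eq_mul]
  have hc2 : 0 < c ^ 2 := by positivity
  rw [cylRadius_smul, abs_of_pos hc, abs_mul, abs_of_pos hc, div_pow, lt_div_iff₀ hc,
    lt_div_iff₀ hc, show -(r ^ 2 / c ^ 2) = (-(r ^ 2)) / c ^ 2 by ring, div_lt_iff₀ hc2]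
  constructor
  · rintro ⟨⟨h1, h2⟩, h3, h4⟩
    exact ⟨⟨by linarith, by nlinarith⟩, by linarith, by linarith⟩
  · rintro ⟨⟨h1, h2⟩, h3, h4⟩
    exact ⟨⟨by linarith, by nlinarith⟩, by linarith, by linarith⟩

/-- Inclusion of a cylinder hanging from a time `t₀ ≤ 0` into a cylinder hanging from time `0`
with the same spatial centre: `Q((t₀, x₀), r) ⊆ Q((0, x₀), r')` as soon as `r ≤ r'` and
`r'² ≥ r² - t₀`. [folklore] -/
theorem parCyl_subset_parCyl_zero_time {x₀ : ℝ³} {t₀ r r' : ℝ} (ht₀ : t₀ ≤ 0) (hr : r ≤ r')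
    (h : r ^ 2 - t₀ ≤ r' ^ 2) : parCyl (t₀, x₀) r ⊆ parCyl ((0 : ℝ), x₀) r' := by
  intro z hz
  rw [mem_parCyl] at hz ⊢
  obtain ⟨⟨h1, h2⟩, h3, h4⟩ := hz
  exact ⟨⟨by simp only at h1 ⊢; linarith, by simp only at h2 ⊢; linarith⟩, h3.trans_le hr,
    h4.trans_le hr⟩

/-- `∫_{Q(z₀, r)} |p|^{3/2} = r² D(z₀, r; p)` for `r > 0`. [folklore] -/
theorem setLIntegral_eq_mul_pressureD (z₀ : ℝ × ℝ³) {r : ℝ} (hr : 0 < r) (p : ℝ → ℝ³ → ℝ) :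
    ∫⁻ z in parCyl z₀ r, ‖p z.1 z.2‖ₑ ^ (3 / 2 : ℝ) = ENNReal.ofReal r ^ 2 * pressureD z₀ r p := by
  rw [pressureD, ← mul_assoc, ENNReal.mul_inv_cancel (by positivity) (by simp), one_mul]

/-- The pressure functional is dominated by the sum of the four functionals. [folklore] -/
theorem pressureD_le_sum (z₀ : ℝ × ℝ³) (r : ℝ) (u : ℝ → ℝ³ → ℝ³) (G : ℝ → ℝ³ → ℝ³ →L[ℝ] ℝ³)
    (p : ℝ → ℝ³ → ℝ) :
    pressureD z₀ r p ≤ energyA z₀ r u + dissipationE z₀ r G + cubicC z₀ r u + pressureD z₀ r p :=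
  le_add_self

/-- The Type I bound at a point controls how far below `t = 0` it lies in terms of the size of
`|v|` there: `√(-t) M ≤ C`, `M > 0` give `-t ≤ (C/M)²`. [cite: SereginSverak2009, Thm. 3.1 (r3)] -/
theorem neg_le_sq_of_sqrt_mul_le {t M C : ℝ} (ht : t ≤ 0) (hM : 0 < M)
    (h : Real.sqrt (-t) * M ≤ C) : -t ≤ (C / M) ^ 2 := by
  have h1 : Real.sqrt (-t) ≤ C / M := by rwa [le_div_iff₀ hM]
  calc -t = Real.sqrt (-t) ^ 2 := (Real.sq_sqrt (by linarith)).symm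
    _ ≤ (C / M) ^ 2 := pow_le_pow_left₀ (Real.sqrt_nonneg _) h1 2

/-- `x_k - x_{k,3} e₃ = (x_k)' = c • y_k` with `y_k = c⁻¹ (x_k)'`. [folklore] -/
theorem smul_inv_smul_horiz {c : ℝ} (hc : c ≠ 0) (x : ℝ³) : c • (c⁻¹ • horiz x) = horiz x := by
  rw [smul_smul, mul_inv_cancel₀ hc, one_smul]

/-- **The rescaled cylinders sit inside the controlled backward cylinder.** Let `z_k = (t_k, x_k)`,
`c > 0`, `y_k = c⁻¹ (x_k)'` and let `Φ(s, y) = (t_k + c² s, x_{k,3} e₃ + c y)` be the axis-centred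
rescaling of §4 (`c = λ_k`). If `R + |y_k'| ≤ σ/c`, then `Φ` maps `𝒞(R) × ]-R², 0]` into
`{t_k - σ² < t ≤ t_k} × 𝒞(x_k, σ)`. [cite: SereginSverak2009, §4 (the rescaling before (p3), arXiv p. 11)] -/
theorem stAffine_mem_backCyl_of_mem {c σ R : ℝ} (hc : 0 < c) (zk : ℝ × ℝ³)
    (hR : R + cylRadius (c⁻¹ • horiz zk.2) ≤ σ / c) {z : ℝ × ℝ³} (h1 : -R ^ 2 < z.1)
    (h2 : z.1 ≤ 0) (h3 : cylRadius z.2 < R) (h4 : |z.2 2| < R) :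
    stAffine (c ^ 2) c zk.1 (zk.2 2 • eZ) z ∈ backCyl zk σ := by
  have hR0 : 0 < R := (cylRadius_nonneg _).trans_lt h3
  have hyk : 0 ≤ cylRadius (c⁻¹ • horiz zk.2) := cylRadius_nonneg _
  have hRσ' : c * (R + cylRadius (c⁻¹ • horiz zk.2)) ≤ σ := by
    have := mul_le_mul_of_nonneg_left hR hc.le
    rwa [mul_div_cancel₀ _ hc.ne'] at this
  have hRσ : c * R ≤ σ := by nlinarith
  rw [mem_backCyl]
  simp only [stAffine_fst, stAffine_snd]
  refine ⟨⟨?_, ?_⟩, ?_, ?_⟩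
  · have h6 : c ^ 2 * R ^ 2 ≤ σ ^ 2 := by
      rw [← mul_pow]; exact pow_le_pow_left₀ (by positivity) hRσ 2
    have h5 : -(c ^ 2 * R ^ 2) < c ^ 2 * z.1 := by nlinarith [pow_pos hc 2]
    linarith
  · nlinarith [pow_pos hc 2]
  · have e : zk.2 2 • eZ + c • z.2 - zk.2 = c • (z.2 - c⁻¹ • horiz zk.2) := by
      rw [smul_sub, smul_inv_smul_horiz hc.ne']
      unfold horiz
      abel
    rw [e, cylRadius_smul, abs_of_pos hc]
    have h7 : cylRadius (z.2 - c⁻¹ • horiz zk.2) ≤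
        cylRadius z.2 + cylRadius (c⁻¹ • horiz zk.2) := by
      have := cylRadius_add_le z.2 (-(c⁻¹ • horiz zk.2))
      rwa [cylRadius_neg, ← sub_eq_add_neg] at this
    nlinarith [mul_le_mul_of_nonneg_left h7 hc.le]
  · have e : (zk.2 2 • eZ + c • z.2 : ℝ³) 2 - zk.2 2 = c * z.2 2 := by
      rw [smul_eZ_add_smul_apply_two]; ring
    rw [e, abs_mul, abs_of_pos hc]
    nlinarith

/-- The same for the points of the open cylinder `Q(0, R)`. [folklore] -/
theorem stAffine_mem_backCyl {c σ R : ℝ} (hc : 0 < c) (zk : ℝ × ℝ³)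
    (hR : R + cylRadius (c⁻¹ • horiz zk.2) ≤ σ / c) {z : ℝ × ℝ³} (hz : z ∈ parCyl 0 R) :
    stAffine (c ^ 2) c zk.1 (zk.2 2 • eZ) z ∈ backCyl zk σ := by
  rw [mem_parCyl_zero] at hz
  exact stAffine_mem_backCyl_of_mem hc zk hR hz.1.1 hz.1.2.le hz.2.1 hz.2.2

/-- Under the same rescaling, `Q(0, R) ⊆ Φ⁻¹(S)` as soon as the backward cylinder of the
previous lemma lies in `S`. [folklore] -/
theorem parCyl_subset_preimage_stAffine {c σ R : ℝ} (hc : 0 < c) (zk : ℝ × ℝ³)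
    (hR : R + cylRadius (c⁻¹ • horiz zk.2) ≤ σ / c) {S : Set (ℝ × ℝ³)}
    (hS : backCyl zk σ ⊆ S) :
    parCyl 0 R ⊆ stAffine (c ^ 2) c zk.1 (zk.2 2 • eZ) ⁻¹' S := fun _ hz =>
  hS (stAffine_mem_backCyl hc zk hR hz)

/-- For the time coordinate alone: `(s, 0) ∈ Q(0, R)` for `-R² < s < 0`, so the rescaled time
`t_k + c² s` is the time of a point of the backward cylinder. [folklore] -/
theorem mem_parCyl_zero_of_time {R s : ℝ} (hR : 0 < R) (hs : s ∈ Ioo (-R ^ 2) 0) :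
    ((s, 0) : ℝ × ℝ³) ∈ parCyl 0 R := by
  rw [mem_parCyl_zero]
  refine ⟨hs, ?_, ?_⟩
  · simpa [cylRadius] using hR
  · simpa using hR

/-- The normalised horizontal offset `y_k = c⁻¹ (x_k)'` has norm `c⁻¹ |x_k'|` (`c > 0`).
[folklore] -/
theorem norm_inv_smul_horiz {c : ℝ} (hc : 0 < c) (x : ℝ³) :
    ‖c⁻¹ • horiz x‖ = c⁻¹ * cylRadius x := by
  rw [norm_smul, Real.norm_eq_abs, abs_of_pos (inv_pos.2 hc), norm_horiz]

/-- `|(x')'| = |x'|`. [folklore] -/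
@[simp] theorem cylRadius_horiz (x : ℝ³) : cylRadius (horiz x) = cylRadius x := by
  simp [cylRadius]

/-- … and cylindrical radius `c⁻¹ |x_k'|`. [folklore] -/
theorem cylRadius_inv_smul_horiz {c : ℝ} (hc : 0 < c) (x : ℝ³) :
    cylRadius (c⁻¹ • horiz x) = c⁻¹ * cylRadius x := by
  rw [cylRadius_smul, abs_of_pos (inv_pos.2 hc), cylRadius_horiz]

/-- The rescaling sends `(0, y_k)` to `z_k`: `Φ(0, c⁻¹ (x_k)') = (t_k, x_k)`. [folklore] -/
theorem stAffine_zero_inv_smul_horiz {c : ℝ} (hc : c ≠ 0) (zk : ℝ × ℝ³) :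
    stAffine (c ^ 2) c zk.1 (zk.2 2 • eZ) ((0 : ℝ), c⁻¹ • horiz zk.2) = zk := by
  rw [stAffine_apply, mul_zero, add_zero, smul_inv_smul_horiz hc, add_comm, horiz_add_smul_eZ]

end SereginSverak2009

end Literature.Analysis.FluidPDE
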